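import Summits.ResolutionOfSingularities.ResolutionOfSingularities.Theorems.PurelyInseparableDim4IsolatedScope
import Summits.ResolutionOfSingularities.ResolutionOfSingularities.Theorems.PurelyInseparableDim4EquimultipleScope
import Literature.AlgebraicGeometry.Resolution.AdditiveFormsStructure
import Literature.RingTheory.MvPolynomial.VariableIdeals
import Mathlib.RingTheory.MvPolynomial.Ideal
import Mathlib.Algebra.CharP.Basic
import HarnessLib
import HarnessLib.Audit.Tags

/-!
# Purely inseparable fourfolds — PERMISSIBLE ⟺ `J_p⁺(F) ≤ (x_S)` for clean states; the in-scope dictionary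
# [OURS · counted 0 · statements about OUR frame (`PurelyInseparableDim4Scope`), not about resolution]

Census cell «res-dim4-pi» (D-0157 DOOR 2), width seat `res-dim4-p-14`, brick PR-12l.  p-12's PR-8
(`IsolatedScope.singLocusIdeal_le_span_X`) proves: if the coordinate centre `V(z, x_S)` is
Hironaka-permissible for `z^q + F` (`q ≤ ord_{(x_S)} F`) then `J_q⁺(F) ≤ (x_S)`.  This DEF-FREE file
proves the CONVERSE at the exponent of record `q = p` (prime = the characteristic) for CLEAN `F`
(every monomial has an exponent prime to `p` — the walk's states are cleaned):

* `coeff_sub_hasseDeriv` — `coeff_{d−α}(D^{(α)}F) = (∏ C(dᵢ, αᵢ))·coeff_d F` for `α ≤ d`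
  (the tree's `Resolution.coeff_hasseDeriv` through typ-3's bridge `Equimultiple.hasseDeriv_eq`);
* **`le_ordAlong_of_singLocusIdeal_le_span_X`**: `J_p⁺(F) ≤ (x_S) → p ≤ ord_{(x_S)} F` — a monomial of
  `S`-degree `m ∈ (0, p)` is seen by `D^{(d|_S)}` (coefficient `coeff_d F`: all binomials `C(dᵢ,dᵢ) = 1`),
  one of `S`-degree `0` by `D^{(eᵢ)}` with `p ∤ dᵢ` (cleanliness; coefficient `dᵢ·coeff_d F ≠ 0` in
  characteristic `p`); either way the surviving monomial has no variable of `S`;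
* **`isPermissibleCentre_iff_singLocusIdeal_le`** — for clean states «`V(z,x_S)` permissible» IS
  «`(x_S) ⊇ J_p⁺(F)`» = «`V(x_S)` lies in the `p`-fold locus» (the Sage lane's language, EN-9);
* the IN-SCOPE DICTIONARY: `singLocusIdeal_ne_bot` (clean, `F ≠ 0`),
  **`span_X_mem_minimalPrimes_of_minimal`** (in scope, an inclusion-MINIMAL permissible `S` — a LARGEST
  permissible coordinate centre — spans a MINIMAL PRIME of `J_p⁺(F)`: that centre is a whole COMPONENT
  of the `p`-fold locus through the point) and **`exists_proper_permissible_of_not_isIsolated`** (an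
  in-scope, non-isolated, `p`-fold clean state has a permissible PROPER centre `S ≠ univ` spanning a
  minimal prime — only ISOLATED in-scope states force the point).

Nothing here proves resolution of singularities in dimension ≥ 4 / characteristic `p`; counted 0;
AI work, weaker than expert review.
bears_on: LADDER-RESOLUTION:D157-DOOR2 (res-dim4-pi · PR-12l). Supports stmt-ResolutionOfSingularities-16155
(helper).
-/

set_option linter.dupNamespace false

noncomputable section

namespace Summit.ResolutionOfSingularities.ResolutionOfSingularities.Theorems.PIDim4

namespace ScopeDictionary

open MvPolynomial
open Literature.AlgebraicGeometry.Resolution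
open Literature.RingTheory.MvPolynomial (isPrime_span_X_image span_X_image_le_iff)

variable {K : Type} [Field K]

/-! ## 1. Coefficients of the frame's Hasse derivatives -/

/-- `coeff_{d−α}(D^{(α)} F) = (∏_{i ∈ supp α} C(dᵢ, αᵢ)) · coeff_d F` for `α ≤ d`.
[cite: EGAIV4, Thm. 16.11.2 (16.11.2.1)] [folklore] -/
theorem coeff_sub_hasseDeriv {α d : Fin 4 →₀ ℕ} (hαd : α ≤ d) (F : MvPolynomial (Fin 4) K) :
    coeff (d - α) (hasseDeriv α F) = ((∏ i ∈ α.support, (d i).choose (α i) : ℕ) : K) * coeff d F := by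
  classical
  rw [Equimultiple.hasseDeriv_eq, Literature.AlgebraicGeometry.Resolution.coeff_hasseDeriv,
    add_tsub_cancel_of_le hαd]

/-- A polynomial with a monomial free of the variables of `S` is not in `(x_S)`. [folklore] -/
theorem not_mem_span_X_of_coeff_ne_zero {S : Finset (Fin 4)} {G : MvPolynomial (Fin 4) K}
    {β : Fin 4 →₀ ℕ} (hβ : coeff β G ≠ 0) (hS : ∀ i ∈ S, β i = 0) :
    G ∉ Ideal.span ((fun i => (X i : MvPolynomial (Fin 4) K)) '' (S : Set (Fin 4))) := by
  intro hG
  obtain ⟨i, hi, hne⟩ :=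
    (MvPolynomial.mem_ideal_span_X_image.mp hG) β (MvPolynomial.mem_support_iff.mpr hβ)
  exact hne (hS i (Finset.mem_coe.mp hi))

/-! ## 2. The converse: `J_p⁺(F) ≤ (x_S)` forces permissibility, for clean `F` -/

/-- **`J_p⁺(F) ≤ (x_S) ⇒ p ≤ ord_{(x_S)} F`** for `F` clean (every monomial has an exponent prime to
`p`) over a field of characteristic `p`. [folklore] -/
theorem le_ordAlong_of_singLocusIdeal_le_span_X {p : ℕ} [hp : Fact p.Prime] [CharP K p]
    {S : Finset (Fin 4)} {F : MvPolynomial (Fin 4) K} (hclean : ∀ d ∈ F.support, ∃ i, ¬ p ∣ d i)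
    (hJ : singLocusIdeal p F ≤ Ideal.span ((fun i => (X i : MvPolynomial (Fin 4) K)) '' (S : Set (Fin 4)))) :
    (p : ℕ∞) ≤ CentreBlowup.ordAlong S F := by
  classical
  refine CentreBlowup.le_ordAlong_of_forall fun d hd => ?_
  have hcd : coeff d F ≠ 0 := MvPolynomial.mem_support_iff.mp hd
  by_contra hlt
  push Not at hlt
  by_cases hm : CentreBlowup.degIn S d = 0
  · -- no variable of `S` occurs in `x^d`: detect it with `D^{(eᵢ)}`, `p ∤ dᵢ`
    obtain ⟨i, hi⟩ := hclean d hd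
    have hdi : d i ≠ 0 := fun h0 => hi (by rw [h0]; exact dvd_zero p)
    have hiS : i ∉ S := fun hiS => hdi ((Finset.sum_eq_zero_iff.mp hm) i hiS)
    have hαd : Finsupp.single i 1 ≤ d := by
      refine Finsupp.le_def.mpr fun j => ?_
      by_cases hji : j = i
      · subst hji; rw [Finsupp.single_eq_same]; omega
      · rw [Finsupp.single_eq_of_ne hji]; exact Nat.zero_le _
    have hmem : hasseDeriv (Finsupp.single i 1) F ∈ singLocusIdeal p F :=
      Ideal.subset_span ⟨Finsupp.single i 1, by rw [Finsupp.degree_single]; exact Nat.one_pos,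
        by rw [Finsupp.degree_single]; exact hp.out.one_lt, rfl⟩
    refine not_mem_span_X_of_coeff_ne_zero (β := d - Finsupp.single i 1) ?_ ?_ (hJ hmem)
    · rw [coeff_sub_hasseDeriv hαd, Finsupp.support_single _ one_ne_zero,
        Finset.prod_singleton, Finsupp.single_eq_same, Nat.choose_one_right]
      refine mul_ne_zero ?_ hcd
      rw [Ne, CharP.cast_eq_zero_iff K p]
      exact hi
    · intro j hj
      have hji : j ≠ i := fun h => hiS (h ▸ hj)
      rw [Finsupp.tsub_apply, Finsupp.single_eq_of_ne hji, Nat.sub_zero]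
      exact (Finset.sum_eq_zero_iff.mp hm) j hj
  · -- `0 < deg_S d < p`: detect `x^d` with `D^{(α)}`, `α = d|_S`
    set α : Fin 4 →₀ ℕ := d.filter (fun i => i ∈ S) with hα
    have hαi : ∀ i, α i = if i ∈ S then d i else 0 := fun i => by rw [hα, Finsupp.filter_apply]
    have hαd : α ≤ d := Finsupp.le_def.mpr fun i => by rw [hαi]; split_ifs <;> omega
    have hdegα : α.degree = CentreBlowup.degIn S d := by
      rw [← CentreBlowup.degIn_univ]
      unfold CentreBlowup.degIn
      simp_rw [hαi]
      rw [Finset.sum_ite_mem, Finset.univ_inter]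
    have hmem : hasseDeriv α F ∈ singLocusIdeal p F :=
      Ideal.subset_span ⟨α, by rw [hdegα]; exact Nat.pos_of_ne_zero hm, by rw [hdegα]; exact hlt, rfl⟩
    refine not_mem_span_X_of_coeff_ne_zero (β := d - α) ?_ ?_ (hJ hmem)
    · rw [coeff_sub_hasseDeriv hαd, Finset.prod_eq_one fun i hi => ?_, Nat.cast_one, one_mul]
      · exact hcd
      · have hiS : i ∈ S := by
          by_contra hiS
          rw [Finsupp.mem_support_iff, hαi, if_neg hiS] at hi
          exact hi rfl
        rw [hαi, if_pos hiS, Nat.choose_self]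
    · intro j hj
      rw [Finsupp.tsub_apply, hαi, if_pos hj, Nat.sub_self]

/-- A cleaned residual polynomial has only monomials with some exponent prime to `p`. [folklore] -/
theorem exists_not_dvd_of_deletePthPowers_eq (p : ℕ) {F : MvPolynomial (Fin 4) K}
    (hclean : Hauser2010.deletePthPowers p F = F) {d : Fin 4 →₀ ℕ} (hd : d ∈ F.support) :
    ∃ i, ¬ p ∣ d i := by
  classical
  by_contra h
  push Not at h
  have hpth : Hauser2010.IsPthPowerExponent p d := (Hauser2010.isPthPowerExponent_iff p d).mpr h
  have hc := Hauser2010.coeff_deletePthPowers p F d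
  rw [hclean, if_pos hpth] at hc
  exact (MvPolynomial.mem_support_iff.mp hd) hc

/-- **PERMISSIBLE ⟺ `J_p⁺(F) ≤ (x_S)`** for clean states (`S ≠ ∅`) over a field of characteristic `p`.
[folklore] -/
theorem isPermissibleCentre_iff_singLocusIdeal_le {p : ℕ} [Fact p.Prime] [CharP K p]
    {S : Finset (Fin 4)} (hS : S.Nonempty) {F : MvPolynomial (Fin 4) K}
    (hclean : ∀ d ∈ F.support, ∃ i, ¬ p ∣ d i) :
    IsPermissibleCentre p S F ↔
      singLocusIdeal p F ≤ Ideal.span ((fun i => (X i : MvPolynomial (Fin 4) K)) '' (S : Set (Fin 4))) :=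
  ⟨fun h => IsolatedScope.singLocusIdeal_le_span_X h.2,
    fun h => ⟨hS, le_ordAlong_of_singLocusIdeal_le_span_X hclean h⟩⟩

/-! ## 3. The in-scope dictionary -/

/-- A clean non-zero `F` has `J_p⁺(F) ≠ 0` (some first Hasse derivative survives). [folklore] -/
theorem singLocusIdeal_ne_bot {p : ℕ} [hp : Fact p.Prime] [CharP K p] {F : MvPolynomial (Fin 4) K}
    (hF : F ≠ 0) (hclean : ∀ d ∈ F.support, ∃ i, ¬ p ∣ d i) : singLocusIdeal p F ≠ ⊥ := by
  classical
  intro hbot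
  have hle : singLocusIdeal p F ≤
      Ideal.span ((fun i => (X i : MvPolynomial (Fin 4) K)) '' ((∅ : Finset (Fin 4)) : Set (Fin 4))) := by
    rw [hbot]; exact bot_le
  have h := le_ordAlong_of_singLocusIdeal_le_span_X hclean hle
  rw [CentreBlowup.ordAlong_empty hF] at h
  have : p ≤ 0 := by exact_mod_cast h
  exact absurd this (not_le.mpr hp.out.pos)

/-- **In scope, an inclusion-minimal permissible centre spans a minimal prime of `J_p⁺(F)`**: a LARGEST
permissible coordinate centre `V(z, x_S)` is a whole component of the `p`-fold locus through the point
(clean `F ≠ 0`, `(x_S) ≤ 𝔪₀` automatic). [folklore] -/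
theorem span_X_mem_minimalPrimes_of_minimal {p : ℕ} [Fact p.Prime] [CharP K p]
    {F : MvPolynomial (Fin 4) K} (hF : F ≠ 0) (hclean : ∀ d ∈ F.support, ∃ i, ¬ p ∣ d i)
    (hsc : InCoordinateScope p F) {S : Finset (Fin 4)} (hS : IsPermissibleCentre p S F)
    (hmin : ∀ T : Finset (Fin 4), T ⊆ S → IsPermissibleCentre p T F → T = S) :
    Ideal.span ((fun i => (X i : MvPolynomial (Fin 4) K)) '' (S : Set (Fin 4))) ∈
      (singLocusIdeal p F).minimalPrimes := by
  haveI hprime : (Ideal.span ((fun i => (X i : MvPolynomial (Fin 4) K)) '' (S : Set (Fin 4)))).IsPrime :=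
    isPrime_span_X_image (S : Set (Fin 4))
  obtain ⟨P, hP, hPS⟩ := Ideal.exists_minimalPrimes_le (IsolatedScope.singLocusIdeal_le_span_X hS.2)
  have hP0 : P ≤ originIdeal K := hPS.trans (IsolatedScope.span_X_image_le_originIdeal _)
  obtain ⟨T, rfl⟩ := hsc P hP hP0
  have hTS : (T : Set (Fin 4)) ⊆ (S : Set (Fin 4)) := span_X_image_le_iff.mp hPS
  have hTne : T.Nonempty := by
    by_contra hT
    rw [Finset.not_nonempty_iff_eq_empty] at hT
    subst hT
    apply singLocusIdeal_ne_bot hF hclean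
    have hJ : singLocusIdeal p F ≤ Ideal.span ((fun i => (X i : MvPolynomial (Fin 4) K)) '' ((∅ : Finset (Fin 4)) : Set (Fin 4))) := hP.1.2
    rw [Finset.coe_empty, Set.image_empty, Ideal.span_empty] at hJ
    exact le_bot_iff.mp hJ
  have hTperm : IsPermissibleCentre p T F :=
    (isPermissibleCentre_iff_singLocusIdeal_le hTne hclean).mpr hP.1.2
  have hT : T = S := hmin T (Finset.coe_subset.mp hTS) hTperm
  subst hT
  exact hP

/-- **An in-scope, non-isolated, `p`-fold clean state has a permissible PROPER coordinate centre that is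
a component of the `p`-fold locus** (`S ≠ univ`, `(x_S)` a minimal prime of `J_p⁺(F)`): player A can
name a whole component; only isolated in-scope states force the point (`F ≠ 0`). [folklore] -/
theorem exists_proper_permissible_of_not_isIsolated {p : ℕ} [Fact p.Prime] [CharP K p]
    {F : MvPolynomial (Fin 4) K} (hF : F ≠ 0) (hclean : ∀ d ∈ F.support, ∃ i, ¬ p ∣ d i)
    (hJ : singLocusIdeal p F ≤ originIdeal K) (hsc : InCoordinateScope p F) (hni : ¬ IsIsolated p F) :
    ∃ S : Finset (Fin 4), S ≠ Finset.univ ∧ IsPermissibleCentre p S F ∧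
      Ideal.span ((fun i => (X i : MvPolynomial (Fin 4) K)) '' (S : Set (Fin 4))) ∈
        (singLocusIdeal p F).minimalPrimes := by
  classical
  unfold IsIsolated at hni
  push Not at hni
  obtain ⟨P, hP, hP0, hPne⟩ := hni hJ
  obtain ⟨S, rfl⟩ := hsc P hP hP0
  refine ⟨S, fun hSu => hPne ?_, ?_, hP⟩
  · subst hSu
    exact IsolatedScope.originIdeal_eq_span_X.symm
  · have hSne : S.Nonempty := by
      by_contra hS
      rw [Finset.not_nonempty_iff_eq_empty] at hS
      subst hS
      have hJle : singLocusIdeal p F ≤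
          Ideal.span ((fun i => (X i : MvPolynomial (Fin 4) K)) '' ((∅ : Finset (Fin 4)) : Set (Fin 4))) :=
        hP.1.2
      rw [Finset.coe_empty, Set.image_empty, Ideal.span_empty] at hJle
      exact singLocusIdeal_ne_bot hF hclean (le_bot_iff.mp hJle)
    exact (isPermissibleCentre_iff_singLocusIdeal_le hSne hclean).mpr hP.1.2

end ScopeDictionary

end Summit.ResolutionOfSingularities.ResolutionOfSingularities.Theorems.PIDim4

end
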